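import Summits.CriticalPhenomena.Ising3DConformalLimit.Theses.EnergyNotSigmaSquared
import Summits.CriticalPhenomena.Ising3DConformalLimit.Theses.FKParityRobustness
import Summits.CriticalPhenomena.Ising3DConformalLimit.Theorems.FKParityRobustnessStrandsJoinBound
import Summits.CriticalPhenomena.Ising3DConformalLimit.Theorems.FKParityRobustnessLatticeBoundFromStrands
import Summits.CriticalPhenomena.Ising3DConformalLimit.Theorems.FKParityRobustnessShadowGivesJoin
import Summits.CriticalPhenomena.Ising3DConformalLimit.Theorems.FKParityRobustnessDepletionBound
import HarnessLib

/-!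
# `GapForcesFarMerging` (stmt-CriticalPhenomena-4468) from the sibling cruxes of route `FKParityRobustness`

Route decl: `Summit.CriticalPhenomena.Ising3DConformalLimit.Theses.EnergyNotSigmaSquared.GapForcesFarMerging`
(`= EnergyGapPowerLaw → FarMerging`, where `FarMerging` is the lattice Aizenman criterion
`∃ c > 0, ∃ x injective, ∀ L₀ ∃ L ≥ L₀, U₄^latt(L·x) ≤ -c ⟨σ_{Lx₀}σ_{Lx₁}⟩⟨σ_{Lx₂}σ_{Lx₃}⟩`).

Purpose (lead seat c5, the eighth lead of this crux). Seven leads ran every planned line of this crux to a kernel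
certificate "residual ⇒ crux" and every residual is one open statement (one-passage quasi-multiplicativity /
separation for pairs of SOURCED critical double currents on `ℤ³`; see
`Theorems/EnergyNotSigmaSquaredGapForcesFarMergingPromotion.lean` and `Cruxes/GapForcesFarMerging/CRUX-NOTES-c4.md`).
This file records the EXISTING statement items of the summit that already close the crux outright, so that the
item is parked on them instead of being re-led: the conclusion `FarMerging` of the crux is implied by

* `IndependentStrandsJoin` (stmt-CriticalPhenomena-14625, crux rank 2 of route `FKParityRobustness`, OPEN): two
  independent critical sourced loop-O(1) (high-temperature) configurations at the dilated tetrahedron `l·A` join `a₀`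
  to `a₂` with `ℓ⊗ℓ`-probability `≥ c`, all `l ≥ 1` — through the LANDED supports `strandsJoinBound_proof`
  (stmt-14647: `U₄·(Z⁰)² ≤ -2·JointSum`, Aizenman's identity restricted to odd parts) and
  `latticeBoundFromStrands_proof` (stmt-14648: box → critical state), exactly as composed in the landed
  `joinForcesU4_proof` (stmt-14627);
* `StrandShadow` (stmt-CriticalPhenomena-14626, crux rank 3 of the same route, OPEN) — through the landed
  `depletionBound_proof` (stmt-14628) and `shadowGivesJoin_proof` (stmt-14833: `DepletionBound → StrandShadow →
  IndependentStrandsJoin`).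

Hence `IndependentStrandsJoin → GapForcesFarMerging` and `StrandShadow → GapForcesFarMerging` unconditionally (the
hypothesis `EnergyGapPowerLaw` of the crux is not used: these certificates by-pass the route's transfer mechanism, they do
not realise it). Mathematically trivial given the landed supports; recorded so that the ledger links 4468 to 14625/14626.
Sources: M. Aizenman, Comm. Math. Phys. 86 (1982), Prop. 5.3 [AizenmanCMP1982]; M. Aizenman, H. Duminil-Copin,
Ann. of Math. 194 (2021), eq. (3.11) [AizenmanDuminilCopinAnnals2021].
-/

namespace Summit.CriticalPhenomena.Ising3DConformalLimit.EnergyNotSigmaSquaredGapForcesFarMerging.FromStrands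

open Literature.Probability.LatticeModels
open Summit.CriticalPhenomena.Ising3DConformalLimit.Theses.EnergyNotSigmaSquared (GapForcesFarMerging)
open Summit.CriticalPhenomena.Ising3DConformalLimit.Theses.FKParityRobustness
  (IndependentStrandsJoin StrandShadow)
open Summit.CriticalPhenomena.Ising3DConformalLimit.FKParityRobustnessStrandsJoinBound (strandsJoinBound_proof)
open Summit.CriticalPhenomena.Ising3DConformalLimit.FKParityRobustnessLatticeBoundFromStrands
  (latticeBoundFromStrands_proof tetra_injective)
open Summit.CriticalPhenomena.Ising3DConformalLimit.Theorems (shadowGivesJoin_proof depletionBound_proof)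

/-- **Far merging from `IndependentStrandsJoin`.** If two independent critical sourced loop-O(1) configurations at
the dilated tetrahedra `l·A`, `A = {(−1,−1,−1),(1,1,−1),(1,−1,1),(−1,1,1)}`, join `a₀` to `a₂` with probability `≥ c`
for all `l ≥ 1` (item 14625), then the lattice Aizenman criterion holds along ALL dilations of the injective shape `A`:
`U₄^latt(L·A) ≤ -(2c)·⟨σσ⟩⟨σσ⟩`, hence frequently (`L := max L₀ 1`). Composition of the landed
`latticeBoundFromStrands_proof` and `strandsJoinBound_proof`, as in `joinForcesU4_proof`.
[cite: AizenmanCMP1982, Prop. 5.3] -/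
theorem farMerging_of_independentStrandsJoin :
    IndependentStrandsJoin →
    ∃ c : ℝ, 0 < c ∧ ∃ x : Fin 4 → Site 3, Function.Injective x ∧ ∀ L₀ : ℕ, ∃ L : ℕ, L₀ ≤ L ∧
      criticalCorr 3 4 (fun i => (L : ℤ) • x i) -
          (criticalCorr 3 2 ![(L : ℤ) • x 0, (L : ℤ) • x 1] * criticalCorr 3 2 ![(L : ℤ) • x 2, (L : ℤ) • x 3] +
            criticalCorr 3 2 ![(L : ℤ) • x 0, (L : ℤ) • x 2] * criticalCorr 3 2 ![(L : ℤ) • x 1, (L : ℤ) • x 3] +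
            criticalCorr 3 2 ![(L : ℤ) • x 0, (L : ℤ) • x 3] * criticalCorr 3 2 ![(L : ℤ) • x 1, (L : ℤ) • x 2]) ≤
        -(c * (criticalCorr 3 2 ![(L : ℤ) • x 0, (L : ℤ) • x 1] * criticalCorr 3 2 ![(L : ℤ) • x 2, (L : ℤ) • x 3])) := by
  intro hK1
  obtain ⟨c, hc, hl⟩ := latticeBoundFromStrands_proof hK1 strandsJoinBound_proof
  exact ⟨c, hc, ![![-1, -1, -1], ![1, 1, -1], ![1, -1, 1], ![-1, 1, 1]], tetra_injective,
    fun L₀ => ⟨max L₀ 1, le_max_left _ _, hl (max L₀ 1) (le_max_right _ _)⟩⟩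

/-- **Certificate: `IndependentStrandsJoin` (stmt-CriticalPhenomena-14625) closes the crux `GapForcesFarMerging`
(stmt-CriticalPhenomena-4468) by name.** The energy-gap hypothesis is discarded: the sibling crux gives the conclusion
outright (`farMerging_of_independentStrandsJoin`). [cite: AizenmanCMP1982, Prop. 5.3] -/
theorem gapForcesFarMerging_of_independentStrandsJoin : IndependentStrandsJoin → GapForcesFarMerging :=
  fun hK1 _ => farMerging_of_independentStrandsJoin hK1

/-- **Certificate: `StrandShadow` (stmt-CriticalPhenomena-14626) closes the crux `GapForcesFarMerging`
(stmt-CriticalPhenomena-4468) by name**, through the landed `depletionBound_proof` (stmt-14628) and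
`shadowGivesJoin_proof` (stmt-14833: `DepletionBound → StrandShadow → IndependentStrandsJoin`).
[cite: AizenmanCMP1982, Prop. 5.3] -/
theorem gapForcesFarMerging_of_strandShadow : StrandShadow → GapForcesFarMerging :=
  fun hS => gapForcesFarMerging_of_independentStrandsJoin (shadowGivesJoin_proof depletionBound_proof hS)

end Summit.CriticalPhenomena.Ising3DConformalLimit.EnergyNotSigmaSquaredGapForcesFarMerging.FromStrands
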